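import Mathlib
import HarnessLib
import HarnessLib.Audit
import Summits.AtomisticToContinuum.Statement
import Literature.Geometry.DiscreteGeometry.TwoShellPatterns
import Literature.MathematicalPhysics.StatisticalMechanics.BarlowStacking
import Literature.MathematicalPhysics.StatisticalMechanics.LennardJonesClusters
import Summits.AtomisticToContinuum.Crystallization.Theses.HullMinimality
import Summits.AtomisticToContinuum.Crystallization.Theorems.ReggeStarCoercivityDefectFreeCrystallizesHullCriterion
import Summits.AtomisticToContinuum.Crystallization.Theorems.PhononSlackCertificatesWindowOptimality
import HarnessLib.Audit.Status.Attr

/-!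
Route: BarlowBlindPricedRungs

# Route BarlowBlindPricedRungs — Defect and layering fractions split LJ crystallization; priced
rungs bound defects

It suffices to show X = P₀ ∧ P₁ ∧ P₂ (decomp-a2c node N_C.F, lens 5 «finite certificates»;
conjunct-level). For a sequence x of
Lennard-Jones ground states let F1(x) = «the fraction of particles whose TWO-SHELL environment is
not (1/20)-close to a Barlow
pattern at a scale a ∈ [47/50, 1] (¬IsTwoShellGood) tends to 0» and F2(x) = «for every η > 0 the
fraction of particles that are not
η-LayeredNear (radius-2 neighbourhood two-way η-matched to a strained Barlow stacking, the text of
stmt-24041) tends to 0».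
P₀ (FractionsFrameAlong, support): F1(x) ∧ F2(x) ⇒ x has periodic windows. P₁ (DefectiveCase, crux,
DECLARED RESIDUAL): ¬F1(x) ⇒
x has periodic windows. P₂ (StrainedCase, crux, attacked): F1(x) ∧ ¬F2(x) ⇒ x has periodic windows.
By excluded middle per sequence
X ⟺ HullMinimality.PeriodicWindows (kernel `periodicWindows_iff_pieces`), and PeriodicWindows ⟹
Crystallization by the landed hull
criterion, window optimality and energy limit; conversely each piece follows from Crystallization
(kernel, via hullCriterionConverse
stmt-11780), so the node is EXACT and every open piece is strictly WEAKER than the conjunct. The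
named sufficient conditions of the
two cruxes are PRICED finite-radius energy-splitting certificates (X₁ TwoShellPricedRungs ⇒ P₁, X₂
FlatPricedRungs ⇒ P₂, kernel
Markov seam in the node file), entered after birth as registered skeleton stubs.
Lean: `Summit.AtomisticToContinuum.Crystallization.Theses.HullMinimality.PeriodicWindows`

## Assembly
Pure logic plus landed theorems: for a ground-state sequence x, `Classical.byCases` on F1(x) and
then on F2(x) dispatches to P₀, P₂
or P₁ and yields HullMinimality.PeriodicWindows; then `PrestressSplitKorn.stub_hullCriterion`
(stmt-3243) gives IsCrystallizing, and
`windowOptimality_proof` (WindowOptimality 13962), `HullMinimality.CrysEnergyLimit_holds`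
(stmt-0626) and
`LennardJonesGroundStatesExist_holds` give HasPeriodicGroundStateEnergy (deciding theorem `closes`
in glue.lean, kernel-checked in
the node file HOME/decomp-a2c-lens-5/BarlowBlindPricedRungsV2.lean together with the converse
`pieces_of_crystallization`).

Rationale: WHY THIS LINE. Mechanism: a radius-R energy-splitting rule (siteE ≥ e∞ − ε at every site of every
δ-separated configuration, IsRule/Feasible of
Theorems.FreeSplittingCertificatesStrictSplittingRuleDefs) that is moreover κ-STRICT on a class of
bad sites turns the global
energy identity Σ siteE = E(N) = N·e⋆ + o(N) into the Markov bound #bad/N ≤ (ε + o(1))/κ; a FAMILY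
of such rules with deficit ε → 0
and one price κ gives a vanishing bad fraction (kernel `tendsto_card_div_of_pricedRules`,
`defectiveCase_of_twoShellPricedRungs`).
This is the Delsarte/Cohn–Elkies move (exhibit the dual certificate and the inequality proves
itself; HalesDSP2012 linear programs,
arXiv:1902.05438 interpolation certificates) transplanted from packing density to DEFECT DENSITY of
LJ ground states, with the
2D local-energy proofs (HeitmannRadin1980, Radin1981, Theil2006, arXiv:1605.00034 energy
decomposition + defect measure) as the
model and FlatleyTheil2015 as the only 3D precedent (fcc local minimality under an added three-body
term). What the line does
that prior routes and the negatives index do not: the case predicates are DENSITIES, so the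
sufficient conditions are decidable
rung by rung in the tree's RadiusLadder vocabulary (ε-rungs ARungAt, 204 landed files) and the seam
to the conjunct is counting
proved in kernel — no single-shell rigidity (15929, 4146 refuted), no linear-in-mismatch pricing
(17253 refuted: fixed tolerance
1/20 and a scale window instead), no hull/recurrence object and no levy glue.

RANKED CRUXES. #2 DefectiveCase (crux) — for every sequence x of Lennard-Jones ground states, if the
fraction of particles i with ¬IsTwoShellGood (1/20) (47/50) 1 (x N) i does NOT tend to 0, then x has
periodic windows (HullMinimality spelling, window named W). Exact complement of F1; necessary
(kernel `defectiveCase_of_periodicWindows`); DECLARED RESIDUAL; named sufficient condition X₁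
TwoShellPricedRungs (kernel `defectiveCase_of_twoShellPricedRungs`), and lens-6's 24039 ∧ 24040
(which give F1 outright). [difficulty: open-problem] (why it might fail: Kernel consequence of
Crystallization, so only the ATTACK can fail: a ground-state sequence keeping a positive fraction of
Frank–Kasper / icosahedral / >5%-strained two-shell environments at energy density e⋆ admits no
uniform price κ > 0 (X₁ false), and P₁ is then the whole conjecture on it.) [Miekisz1998,
BlancLewin2015, FlatleyTheil2015, Hales2012, stmt-AtomisticToContinuum-24039,
stmt-AtomisticToContinuum-24040, stmt-AtomisticToContinuum-17253]
#3 StrainedCase (crux) — for every sequence x of Lennard-Jones ground states whose two-shell-bad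
fraction tends to 0 but for which, for some η > 0, the fraction of particles that are not
η-LayeredNear (stmt-24041 text) does not tend to 0, x has periodic windows. Exact complement of F2
given F1; necessary (kernel `strainedCase_of_periodicWindows`); implied VERBATIM by lens-6's
StrainRelaxation stmt-24041 (kernel `strainedCase_of_strainRelaxation`) and by X₂ FlatPricedRungs
(kernel `strainedCase_of_flatPricedRungs`). [difficulty: XL] (why it might fail: Kernel consequence
of Crystallization; the ATTACK (24041 / X₂) fails if ground states carry a non-vanishing density of
slowly varying strain gradients or incoherent Barlow junctions among two-shell-good sites whose
excess energy per site → 0 (no layering price κ(η) at any finite radius).) [EMing2006,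
FrieseckeTheil2002, HalesDSP2012, AyalaChoksiWirth2025, stmt-AtomisticToContinuum-24041,
stmt-AtomisticToContinuum-13958]
#9 FractionsFrameAlong (support) — for every sequence x of Lennard-Jones ground states, if the
two-shell-bad fraction tends to 0 and for every η > 0 the non-η-LayeredNear fraction tends to 0,
then x has periodic windows (the per-sequence form of lens-6's frame stmt-24042 / the NearFar glue
chain LayeredWindows_proof → PeriodicGivenLayered_of; provable now, one `exact` once
Theorems.PhononSlackCertificatesNearFarGlueRRouteNeeds rebuilds). [difficulty: provable-now]
[stmt-AtomisticToContinuum-24042, stmt-AtomisticToContinuum-24041, HalesDSP2012]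

TWO-LAYER PLAN. P₁ ⇐ (FeasibleLadderAt δ: for every ε > 0 a finite-radius δ-rule with deficit ε —
the ε-rung ladder) → (PriceTransferAt δ: one κ > 0
such that every feasible finite-radius rule can be re-mixed at the same radius and deficit into one
κ-strict on two-shell-bad sites)
→ P₁, glue `twoShellPricedRungsAt_of_ladder_transfer` + `defectiveCase_of_twoShellPricedRungs` (both
kernel in the node file; δ = the
ground-state hard core, 7/10 once ChessboardParticlePlanesLjLaminarWindowsMinDistance p115815
rebuilds, else LennardJonesMinimalDistance).
P₂ ⇐ (24041 StrainRelaxation, cited by signature) or (FeasibleLadderAt δ → flat price transfer on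
non-LayeredNear sites → P₂). Registered
as BC3 skeleton stubs right after birth; nothing else filed now.

KILL CRITERIA. No refutation of P₀, P₁ or P₂ is possible without refuting `Crystallization` (each is
a kernel consequence): a refuted piece closes
the SUMMIT conjunct negatively. The LINE dies (pivot P₁ to an UNDECIDED energy-comparison piece, or
retire to lens-6's exposure split
24039/24040) if the census finds a 7/10-separated periodic configuration all of whose sites are
two-shell-bad (A15, σ, C14/C15, bcc,
>6%-dilated Barlow) with LJ energy per particle within 1e-4 of e_hcp, i.e. no price κ; the X₂ branch
dies the same way on strained /
junction textures (then P₂ rests on 24041 alone). Proved elsewhere that moots it: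
DefectFreeGroundStates 11623-type F1∧F2 theorems
(FreeSplittingCertificates, CohesionFrustrationStrain) make P₁, P₂ vacuous.

NOT DECOMPOSED YET. The price-transfer step itself (how a feasible rung is re-mixed into a strict
one: LP duality at fixed radius with the two-shell-bad
rows as strictness constraints), the radius at which ε/κ < 1 first holds (heuristically R ≈ 4.3
nn-distances, beyond today's LP reach
R ≈ 1.2), the choice of δ (7/10 vs 1/3), and the layering tolerance bookkeeping inside P₀ — all
layer-2, after birth.

CHEAPEST FALSIFIER. (i) Census table I-R already asked by lens-4 (cell INBOX 2026-08-30): relaxed LJ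
energy per particle of A15 / σ / C14 / C15 / bcc and
of ≥6%-strained hcp/fcc vs relaxed hcp — an excess < 1e-4 for any of them kills X₁ (expected ≳
1e-2). (ii) T-lens5 (g0 NODE.md, merged
with lens-6 T5): the priced ε-LP at δ = 7/10, R ∈ {1.9, 2.2, 2.5, 3.0}, margins ε ∈ {1e-2, 3e-3,
1e-3}: report the largest κ*(ε,R) for which
the LP with κ-rows on two-shell-bad sites stays feasible; κ* = 0 at every accessible (ε,R) says
price transfer does not start below
three shells (informative, not fatal). Not runnable by this seat (kit_allowed = false); asked of
decomp-a2c-census-1.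

NUMBERS. Blind tail of a radius-R rule ≈ (πρ/9)·R⁻³ ≈ 0.54·R⁻³ (ρ ≈ 1.55 at nn-distance 0.971);
expected price of non-Barlow two-shell
environments κ ≈ 7e-3 absolute (bcc +4.3 %, Frank–Kasper +1–2 %, 5 % strain 1e-3–1e-2 of |e⋆| ≈
0.72) ⇒ ε/κ < 1 first at R ≈ 4.3;
dilation bound from the 17253 witness κ ≤ 36·s₀²·|e⋆| ≈ 2e-2 (s₀ ≈ 3 % = dilation leaving the scale
window [47/50,1]);
e_fcc − e_hcp ≈ 7.3e-5 (polytype selection is NOT asked of any certificate here — PeriodicWindows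
admits every polytype);
two-shell goodness box: tolerance 1/20, scale a ∈ [47/50, 1] (TwoShellPatterns; 24039–24041);
layering box: in-layer a ∈ [47/50,1],
spacing ∈ [39a/50, 17a/20]; hard core: 1/3 (LennardJonesMinimalDistance_holds), 7/10 landed as
p115815 (module unbuilt today).

DEFINITION REQUESTS. None: all pieces are closed Props over existing declarations (IsTwoShellGood,
IsHaggSeq, triangularVec₁/₂, haggLabel, barlowOffset,
layerNormal, PeriodicConfiguration, IsGroundState, lennardJones).

Novelty: Searches (2026-08-30): lit search --hybrid "local energy inequality per atom crystallization ground
state defect density Lennard-Jones three dimensions" (10 docs: debenedetti2020, arxiv-2107.14020,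
sethna2021 …, none on point); lit vsearch "lower bound on the energy share of each atom by the
crystal energy per particle, strict gap at defect atoms, fraction of defects in minimizers tends to
zero" (8, textbooks only); lit search "Theil proof crystallization two dimensions local" --source
local (6: arxiv-1605.00034, arxiv-0909.0927, doi-10-1007-s00220-014-1981-5, imatrm-tny003); lit
search "face-centred cubic crystallization three-body Flatley" (1: arxiv-1611.07798); lit galaxy
search "Heitmann" / "crystallization conjecture" --star pdf (8+8: MFO report 49/2018
pdf:2188780733400237600, Cohn–Kumar–Miller–Radchenko–Viazovska pdf:4729317813722291780, Leblé
thesis; no LJ-3D certificate paper); lit galaxy search "Heitmann-Radin|Flatley|energy partition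
rule" --star all (36 rows, all off-topic); ledger negatives --problem AtomisticToContinuum (24; 4 on
this conjunct).
Nearest prior art found: [corpus:paper:arxiv-1605.00034 p.4] De Luca–Friesecke, energy = local terms
+ defect measure for Heitmann–Radin and soft 2D potentials; Theil2006 / FlatleyTheil2015 (per-atom
energy lower bound by the crystal value, 2D resp. 3D-with-three-body); HalesDSP2012 (finite-radius
LP certificates for density); [galaxy:pdf:4729317813722291780] Cohn–Kumar–Miller–Radchenko–Viazovska
(dual certificates provi  [refs: arxiv-2107.14020, arxiv-1605.00034, arxiv-0909.0927, doi-10-1007-s00220-014-1981-5, arxiv-1611.07798, paper:arxiv-1605.00034, Theil2006, FlatleyTheil2015, HalesDSP2012]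

Barriers (technique_class: energy-splitting certificates, Markov counting, hull windows): - technique_class: energy-splitting certificates, Markov counting, hull windows
- Literature.Barriers.AtomisticToContinuum.TetrahedralFrustration: it bites on X₁ only (locally,
icosahedral/tetrahedral packing is cheaper per site, so no RADIUS-1 strict rule exists); the bet is
quantitative ultimate frustration — frustration cannot tile space, so a finite-radius (R ≈ 4) rule
sees the forced price; P₁ itself asserts no local statement.
- Literature.Barriers.AtomisticToContinuum.IcosahedralClusters: same placement; no single-shell or
cluster price is claimed, strictness is per site but the rule has radius R and is found by LP over
whole R-neighbourhoods.
- Literature.Barriers.AtomisticToContinuum.DecahedralSoftShell: same; soft decahedral shells are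
two-shell-bad rows the LP must price collectively, and a zero price at all accessible R is the
stated falsifier, not a contradiction.
- Literature.Barriers.AtomisticToContinuum.KissingTwelveDegeneracy: evaded — goodness is TWO-shell
with a radial scale window, never inferred from twelve touching neighbours.
- Literature.Barriers.AtomisticToContinuum.FlexibleKissingArrangements: evaded the same way; the
tolerance 1/20 box is fixed (no τ → 0 limit, cf. 17253).
- Literature.Barriers.AtomisticToContinuum.ShortRangeStackingBlindness: discharged by design
(«Barlow-blind»): no certificate distinguishes polytypes (gap 7e-5 would need R ≈ 20);
PeriodicWindows admits any periodic polytype and selection happens inside the hull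
(PeriodicGivenLaye

sub-problem: Crystallization · status: open · opened planner-decomp-a2c-lens-5-g2-0 2026-08-30T03:04:46Z · rev 0 · ledger route-AtomisticToContinuum-BarlowBlindPricedRungs
GENERATED by the gate from the ledger (D-0016/17). Provers cite these decls: `theorem foo : Summit.AtomisticToContinuum.Crystallization.Theses.BarlowBlindPricedRungs.<Decl> := …` in Summits/AtomisticToContinuum/Crystallization/Theorems/<Name>.lean.
-/

namespace Summit.AtomisticToContinuum.Crystallization.Theses.BarlowBlindPricedRungs

open scoped BigOperators Topology Manifold Classical MeasureTheory ProbabilityTheory Matrix InnerProductSpace ComplexConjugate ContinuousMap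
open Filter Set Function TopologicalSpace MeasureTheory

attribute [summit_statement] _root_.Crystallization

/-- item stmt-AtomisticToContinuum-26211 · crux · rank 2 · open · by planner
why it might fail: Kernel consequence of Crystallization, so only the ATTACK can fail: a ground-state sequence keeping a positive fraction of Frank–Kasper / icosahedral / >5%-strained two-shell environments at energy density e⋆ admits no uniform price κ > 0 (X₁ false), and P₁ is then the whole conjecture on it.
sources: Miekisz1998, BlancLewin2015, FlatleyTheil2015, Hales2012, stmt-AtomisticToContinuum-24039, stmt-AtomisticToContinuum-24040
[crux] for every sequence x of Lennard-Jones ground states, if the fraction of particles i with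
¬IsTwoShellGood (1/20) (47/50) 1 (x N) i does NOT tend to 0, then x has periodic windows
(HullMinimality spelling, window named W). Exact complement of F1; necessary (kernel
`defectiveCase_of_periodicWindows`); DECLARED RESIDUAL; named sufficient condition X₁
TwoShellPricedRungs (kernel `defectiveCase_of_twoShellPricedRungs`), and lens-6's 24039 ∧ 24040
(which give F1 outright). [difficulty: open-problem] -/
@[route_item "route-AtomisticToContinuum-BarlowBlindPricedRungs", crux]
def DefectiveCase : Prop :=
  ∀ x : (N : ℕ) → (Fin N → EuclideanSpace ℝ (Fin 3)), (∀ N, Literature.MathematicalPhysics.StatisticalMechanics.IsGroundState Literature.MathematicalPhysics.StatisticalMechanics.lennardJones (x N)) → ¬ Filter.Tendsto (fun N : ℕ => (Nat.card {i : Fin N // ¬ Literature.Geometry.DiscreteGeometry.IsTwoShellGood (1 / 20) (47 / 50) 1 (x N) i} : ℝ) / N) Filter.atTop (nhds 0) → ∃ W : Literature.MathematicalPhysics.StatisticalMechanics.PeriodicConfiguration 3, ∀ R ε : ℝ, 0 < ε → ∃ᶠ N in Filter.atTop, ∃ t : EuclideanSpace ℝ (Fin 3), (∀ s ∈ W.points,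 ‖s‖ ≤ R → ∃ i : Fin N, dist (x N i + t) s ≤ ε) ∧ (∀ i : Fin N, ‖x N i + t‖ ≤ R → ∃ s ∈ W.points, dist (x N i + t) s ≤ ε)

/-- item stmt-AtomisticToContinuum-26212 · crux · rank 3 · open · by planner
why it might fail: Kernel consequence of Crystallization; the ATTACK (24041 / X₂) fails if ground states carry a non-vanishing density of slowly varying strain gradients or incoherent Barlow junctions among two-shell-good sites whose excess energy per site → 0 (no layering price κ(η) at any finite radius).
sources: EMing2006, FrieseckeTheil2002, HalesDSP2012, AyalaChoksiWirth2025, stmt-AtomisticToContinuum-24041, stmt-AtomisticToContinuum-13958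
[crux] for every sequence x of Lennard-Jones ground states whose two-shell-bad fraction tends to 0
but for which, for some η > 0, the fraction of particles that are not η-LayeredNear (stmt-24041
text) does not tend to 0, x has periodic windows. Exact complement of F2 given F1; necessary (kernel
`strainedCase_of_periodicWindows`); implied VERBATIM by lens-6's StrainRelaxation stmt-24041 (kernel
`strainedCase_of_strainRelaxation`) and by X₂ FlatPricedRungs (kernel
`strainedCase_of_flatPricedRungs`). [difficulty: XL] -/
@[route_item "route-AtomisticToContinuum-BarlowBlindPricedRungs", crux]
def StrainedCase : Prop :=
  ∀ x : (N : ℕ) → (Fin N → EuclideanSpace ℝ (Fin 3)), (∀ N, Literature.MathematicalPhysics.StatisticalMechanics.IsGroundState Literature.MathematicalPhysics.StatisticalMechanics.lennardJones (x N)) → Filter.Tendsto (fun N : ℕ => (Nat.card {i : Fin N // ¬ Literature.Geometry.DiscreteGeometry.IsTwoShellGood (1 / 20) (47 / 50) 1 (x N) i} : ℝ) / N) Filter.atTop (nhds 0) → ¬ (∀ η : ℝ, 0 < η → Filter.Tendsto (fun N : ℕ => ((Finset.univ.filter fun i : Fin N => ¬ (∃ (A : EuclideanSpace ℝ (Fin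 3) →ₗᵢ[ℝ] EuclideanSpace ℝ (Fin 3)) (t : EuclideanSpace ℝ (Fin 3)) (a : ℝ) (s : ℤ → ℤ) (z : ℤ → ℝ), (47 / 50 ≤ a ∧ a ≤ 1 ∧ ∀ m : ℤ, 39 / 50 * a ≤ z (m + 1) - z m ∧ z (m + 1) - z m ≤ 17 / 20 * a) ∧ Literature.MathematicalPhysics.StatisticalMechanics.IsHaggSeq s ∧ let S : Set (EuclideanSpace ℝ (Fin 3)) := Set.range fun l : ℤ × ℤ × ℤ => A (((l.2.1 : ℝ) • Literature.MathematicalPhysics.StatisticalMechanics.triangularVec₁ a) + ((l.2.2 : ℝ) • Literature.MathematicalPhysics.StatisticalMechanics.triangularVec₂ a) + ((Literature.MathematicalPhysics.StatisticalMechanics.haggLabel s l.1 : ℝ) • Literature.MathematicalPhysics.StatisticalMechanics.barlowOffset a) + (z l.1 • Literature.MathematicalPhysics.StatisticalMechanics.layerNormal 1)); (∀ j : Fin N, dist (x N j) (x N i) ≤ 2 → ∃ p ∈ S, dist (x N j + t) p ≤ η) ∧ (∀ p ∈ S, dist p (x N i + t) ≤ 2 → ∃ j : Fin N, dist (x N j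 + t) p ≤ η))).card : ℝ) / N) Filter.atTop (nhds 0)) → ∃ W : Literature.MathematicalPhysics.StatisticalMechanics.PeriodicConfiguration 3, ∀ R ε : ℝ, 0 < ε → ∃ᶠ N in Filter.atTop, ∃ t : EuclideanSpace ℝ (Fin 3), (∀ s ∈ W.points, ‖s‖ ≤ R → ∃ i : Fin N, dist (x N i + t) s ≤ ε) ∧ (∀ i : Fin N, ‖x N i + t‖ ≤ R → ∃ s ∈ W.points, dist (x N i + t) s ≤ ε)

/-- item stmt-AtomisticToContinuum-26213 · support · rank 9 · open · by planner
sources: stmt-AtomisticToContinuum-24042, stmt-AtomisticToContinuum-24041, HalesDSP2012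
[support] for every sequence x of Lennard-Jones ground states, if the two-shell-bad fraction tends
to 0 and for every η > 0 the non-η-LayeredNear fraction tends to 0, then x has periodic windows (the
per-sequence form of lens-6's frame stmt-24042 / the NearFar glue chain LayeredWindows_proof →
PeriodicGivenLayered_of; provable now, one `exact` once
Theorems.PhononSlackCertificatesNearFarGlueRRouteNeeds rebuilds). [difficulty: provable-now] -/
@[route_item "route-AtomisticToContinuum-BarlowBlindPricedRungs", crux]
def FractionsFrameAlong : Prop :=
  ∀ x : (N : ℕ) → (Fin N → EuclideanSpace ℝ (Fin 3)), (∀ N, Literature.MathematicalPhysics.StatisticalMechanics.IsGroundState Literature.MathematicalPhysics.StatisticalMechanics.lennardJones (x N)) → Filter.Tendsto (fun N : ℕ => (Nat.card {i : Fin N // ¬ Literature.Geometry.DiscreteGeometry.IsTwoShellGood (1 / 20) (47 / 50) 1 (x N) i} : ℝ) / N) Filter.atTop (nhds 0) → (∀ η : ℝ, 0 < η → Filter.Tendsto (fun N : ℕ => ((Finset.univ.filter fun i : Fin N => ¬ (∃ (A : EuclideanSpace ℝ (Fin 3) →ₗᵢ[ℝ] EuclideanSpace ℝ (Fin 3)) (t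 : EuclideanSpace ℝ (Fin 3)) (a : ℝ) (s : ℤ → ℤ) (z : ℤ → ℝ), (47 / 50 ≤ a ∧ a ≤ 1 ∧ ∀ m : ℤ, 39 / 50 * a ≤ z (m + 1) - z m ∧ z (m + 1) - z m ≤ 17 / 20 * a) ∧ Literature.MathematicalPhysics.StatisticalMechanics.IsHaggSeq s ∧ let S : Set (EuclideanSpace ℝ (Fin 3)) := Set.range fun l : ℤ × ℤ × ℤ => A (((l.2.1 : ℝ) • Literature.MathematicalPhysics.StatisticalMechanics.triangularVec₁ a) + ((l.2.2 : ℝ) • Literature.MathematicalPhysics.StatisticalMechanics.triangularVec₂ a) + ((Literature.MathematicalPhysics.StatisticalMechanics.haggLabel s l.1 : ℝ) • Literature.MathematicalPhysics.StatisticalMechanics.barlowOffset a) + (z l.1 • Literature.MathematicalPhysics.StatisticalMechanics.layerNormal 1)); (∀ j : Fin N, dist (x N j) (x N i) ≤ 2 → ∃ p ∈ S, dist (x N j + t) p ≤ η) ∧ (∀ p ∈ S, dist p (x N i + t) ≤ 2 → ∃ j : Fin N, dist (x N j + t) p ≤ η))).card : ℝ) / N) Filter.atTop (nhds 0)) → ∃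 W : Literature.MathematicalPhysics.StatisticalMechanics.PeriodicConfiguration 3, ∀ R ε : ℝ, 0 < ε → ∃ᶠ N in Filter.atTop, ∃ t : EuclideanSpace ℝ (Fin 3), (∀ s ∈ W.points, ‖s‖ ≤ R → ∃ i : Fin N, dist (x N i + t) s ≤ ε) ∧ (∀ i : Fin N, ‖x N i + t‖ ≤ R → ∃ s ∈ W.points, dist (x N i + t) s ≤ ε)

/-- item stmt-AtomisticToContinuum-26214 · assembly · rank 1 · open · by planner
sources: stmt-AtomisticToContinuum-3243, stmt-AtomisticToContinuum-11780
[assembly] P₀ → P₁ → P₂ → Crystallization -/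
@[route_item "route-AtomisticToContinuum-BarlowBlindPricedRungs"]
def Assembly : Prop :=
  FractionsFrameAlong → DefectiveCase → StrainedCase → _root_.Crystallization

/-! D-0027 §2.1 — DECIDING THEOREM (planner-authored via `route open/edit --closes-file`; by planner-decomp-a2c-lens-5-g2-0 2026-08-30T03:04:46Z):
its hypotheses are this route's items and its conclusion the sub-problem Statement (glue_lint), and it elaborates with this file. -/

@[closes "route-AtomisticToContinuum-BarlowBlindPricedRungs"] theorem closes (h_FractionsFrameAlong : FractionsFrameAlong) (h_DefectiveCase : DefectiveCase)
    (h_StrainedCase : StrainedCase) : _root_.Crystallization := by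
  -- (1) PERIODIC WINDOWS for every ground-state sequence (HullMinimality spelling): excluded middle per sequence on the
  --     two fraction predicates F1 (two-shell-bad fraction → 0) and F2 (non-layered fraction → 0 for every η):
  --     F1 ∧ F2 ↦ P₀ (frame), ¬F1 ↦ P₁ (DefectiveCase, residual), F1 ∧ ¬F2 ↦ P₂ (StrainedCase).
  have hPW : _root_.Summit.AtomisticToContinuum.Crystallization.Theses.HullMinimality.PeriodicWindows := by
    intro x hx
    exact Classical.byCases
      (fun h1 => Classical.byCases (fun h2 => h_FractionsFrameAlong x hx h1 h2) (fun h2 => h_StrainedCase x hx h1 h2))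
      (fun h1 => h_DefectiveCase x hx h1)
  -- (2) positional conjunct (ii): the landed hull criterion (stmt-3243, `PrestressSplitKorn.stub_hullCriterion`).
  refine ⟨?_, _root_.Summit.AtomisticToContinuum.Crystallization.Theorems.PrestressSplitKorn.stub_hullCriterion hPW⟩
  -- (3) energetic conjunct (i): ground states exist; their window configuration is a periodic minimiser
  --     (`windowOptimality_proof`), so `⨅ = e(P)`, and `E(N)/N → ⨅` (`HullMinimality.CrysEnergyLimit_holds`, stmt-0626).
  have hWO := _root_.Summit.AtomisticToContinuum.Crystallization.Theorems.windowOptimality_proof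
  unfold _root_.Summit.AtomisticToContinuum.Crystallization.Theses.PhononSlackCertificates.WindowOptimality at hWO
  obtain ⟨x, hx⟩ : ∃ x : (N : ℕ) → (Fin N → EuclideanSpace ℝ (Fin 3)),
      ∀ N, Literature.MathematicalPhysics.StatisticalMechanics.IsGroundState
        Literature.MathematicalPhysics.StatisticalMechanics.lennardJones (x N) :=
    ⟨fun N => (Literature.MathematicalPhysics.StatisticalMechanics.LennardJonesGroundStatesExist_holds N).choose,
      fun N => (Literature.MathematicalPhysics.StatisticalMechanics.LennardJonesGroundStatesExist_holds N).choose_spec⟩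
  obtain ⟨P, hP⟩ := hPW x hx
  have hleast : IsLeast (Set.range fun Q : Literature.MathematicalPhysics.StatisticalMechanics.PeriodicConfiguration 3 =>
      Q.energyPerParticle Literature.MathematicalPhysics.StatisticalMechanics.lennardJones)
      (P.energyPerParticle Literature.MathematicalPhysics.StatisticalMechanics.lennardJones) := hWO x hx P hP
  have hinf : (⨅ Q : Literature.MathematicalPhysics.StatisticalMechanics.PeriodicConfiguration 3,
      Q.energyPerParticle Literature.MathematicalPhysics.StatisticalMechanics.lennardJones) =
      P.energyPerParticle Literature.MathematicalPhysics.StatisticalMechanics.lennardJones := hleast.csInf_eq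
  have hE := _root_.Summit.AtomisticToContinuum.Crystallization.Theses.HullMinimality.CrysEnergyLimit_holds
  unfold _root_.Summit.AtomisticToContinuum.Crystallization.Theses.HullMinimality.CrysEnergyLimit at hE
  rw [hinf] at hE
  exact ⟨P, hleast, hE⟩

end Summit.AtomisticToContinuum.Crystallization.Theses.BarlowBlindPricedRungs
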